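import Mathlib
import HarnessLib
import Summits.ValiantsHypothesis.ValiantsHypothesis.Theses.MonotoneRestoration

/-!
# Newton's identities: the product as a universal polynomial in the power sums
(crux `stmt-ValiantsHypothesis-15886`, line `Sketch`, registered stub `newton_prod_eq_aeval_psum`)

Helper file (`--supports stmt-ValiantsHypothesis-15886`) of line `Sketch` of the crux
`Summit.ValiantsHypothesis.ValiantsHypothesis.Theses.MonotoneRestoration.MonotoneRestorationQP`.
The restoration engine behind every known positive instance of the crux ("single-chain" dynamic
programmes) is the following purely algebraic fact: for every `n` there is ONE polynomial
`Q_n ∈ ℚ[y_1, …, y_n]` such that for every commutative `ℚ`-algebra `A` and every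
`a : Fin n → A`,

  `∏ i, a i = Q_n (p_1(a), …, p_n(a))`,   `p_{j+1}(a) = ∑ i, a i ^ (j + 1)`.

Proof: in `MvPolynomial (Fin n) ℚ`, Newton's identities (Mathlib
`MvPolynomial.mul_esymm_eq_sum`, `k e_k = (-1)^{k+1} ∑_{i<k} (-1)^i e_i p_{k-i}`, divided by `k`)
put `e_k`, `k ≤ n`, in the subalgebra generated by `p_1, …, p_n` (strong induction on `k`);
`e_n = ∏ i, X i`; the subalgebra generated by a family is the range of `MvPolynomial.aeval`
(`Algebra.adjoin_range_eq_range_aeval`), which produces `Q_n`; finally apply the `ℚ`-algebra map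
`MvPolynomial.aeval a` (`MvPolynomial.comp_aeval`).

## Main statements

* `NewtonProdPsum.esymm_mem_adjoin_psum` — `e_k ∈ K[p_1, …, p_n]` for `k ≤ n` (`K` a field of
  characteristic `0`; `p_{j+1} = MvPolynomial.psum (Fin n) K (j + 1)`, `j : Fin n`);
* `NewtonProdPsum.exists_prod_X_eq_aeval_psum` — `∏ i, X i = aeval (p_1, …, p_n) Q` for some `Q`;
* `newton_prod_eq_aeval_psum` — the registered stub (universal `Q_n` over `ℚ`, evaluated in any
  commutative `ℚ`-algebra).
-/

-- `ValiantsHypothesis.ValiantsHypothesis`: the D-0017 layout repeats the problem name in the path.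
set_option linter.dupNamespace false

noncomputable section

namespace Summit.ValiantsHypothesis.ValiantsHypothesis.Theorems

open MvPolynomial

namespace NewtonProdPsum

/-- **Newton's identities, subalgebra form**: over a field of characteristic `0`, the elementary
symmetric polynomial `e_k` in `n` variables, `k ≤ n`, lies in the subalgebra generated by the
power sums `p_1, …, p_n` (strong induction on `k` from Mathlib's `MvPolynomial.mul_esymm_eq_sum`,
dividing by `k`). [folklore] -/
theorem esymm_mem_adjoin_psum (K : Type*) [Field K] [CharZero K] (n : ℕ) {k : ℕ} (hk : k ≤ n) :
    esymm (Fin n) K k ∈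
      Algebra.adjoin K (Set.range fun j : Fin n => psum (Fin n) K ((j : ℕ) + 1)) := by
  induction k using Nat.strong_induction_on with
  | _ k ih =>
    rcases Nat.eq_zero_or_pos k with rfl | hpos
    · rw [esymm_zero]
      exact Subalgebra.one_mem _
    have hk0 : (k : K) ≠ 0 := Nat.cast_ne_zero.mpr hpos.ne'
    have key := MvPolynomial.mul_esymm_eq_sum (Fin n) K k
    have hCk : esymm (Fin n) K k =
        (k : K)⁻¹ • ((k : MvPolynomial (Fin n) K) * esymm (Fin n) K k) := by
      rw [smul_eq_C_mul, ← mul_assoc,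
        show (k : MvPolynomial (Fin n) K) = C (k : K) from (map_natCast C k).symm,
        ← map_mul, inv_mul_cancel₀ hk0, C_1, one_mul]
    have hneg : ∀ i : ℕ, (-1 : MvPolynomial (Fin n) K) ^ i ∈
        Algebra.adjoin K (Set.range fun j : Fin n => psum (Fin n) K ((j : ℕ) + 1)) := fun i =>
      Subalgebra.pow_mem _ (Subalgebra.neg_mem _ (Subalgebra.one_mem _)) _
    rw [hCk, key]
    refine Subalgebra.smul_mem _ (Subalgebra.mul_mem _ (hneg _)
      (Subalgebra.sum_mem _ fun a ha => ?_)) _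
    rw [Finset.mem_filter, Finset.HasAntidiagonal.mem_antidiagonal] at ha
    obtain ⟨hab, halt⟩ := ha
    refine Subalgebra.mul_mem _ (Subalgebra.mul_mem _ (hneg _) (ih a.1 halt (by omega))) ?_
    -- the power sum `p_{a.2}` with `1 ≤ a.2 ≤ n` is a generator
    obtain ⟨j, hj⟩ : ∃ j : Fin n, a.2 = (j : ℕ) + 1 :=
      ⟨⟨a.2 - 1, by omega⟩, by simp only; omega⟩
    rw [hj]
    exact Algebra.subset_adjoin ⟨j, rfl⟩

/-- `e_n = ∏ i, X i` in the `n` variables `X 0, …, X (n-1)`. [folklore] -/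
theorem esymm_self_eq_prod_X (K : Type*) [CommRing K] (n : ℕ) :
    esymm (Fin n) K n = ∏ i : Fin n, (X i : MvPolynomial (Fin n) K) := by
  have h := Finset.powersetCard_self (Finset.univ : Finset (Fin n))
  rw [Finset.card_univ, Fintype.card_fin] at h
  rw [esymm, h, Finset.sum_singleton]

/-- **Newton**: `∏ i, X i = Q (p_1, …, p_n)` for some `Q ∈ K[y_1, …, y_n]` (`K` a field of
characteristic `0`). [folklore] -/
theorem exists_prod_X_eq_aeval_psum (K : Type*) [Field K] [CharZero K] (n : ℕ) :
    ∃ Q : MvPolynomial (Fin n) K, (∏ i : Fin n, (X i : MvPolynomial (Fin n) K)) =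
      aeval (fun j : Fin n => psum (Fin n) K ((j : ℕ) + 1)) Q := by
  have h := esymm_mem_adjoin_psum K n (le_refl n)
  rw [esymm_self_eq_prod_X, Algebra.adjoin_range_eq_range_aeval, AlgHom.mem_range] at h
  obtain ⟨Q, hQ⟩ := h
  exact ⟨Q, hQ.symm⟩

end NewtonProdPsum

/-- **Newton's identities, universal-polynomial form** (registered stub `newton_prod_eq_aeval_psum`
of line `Sketch`): for every `n` there is one polynomial `Q ∈ ℚ[y_1, …, y_n]` such that in every
commutative `ℚ`-algebra `A`, for every `a : Fin n → A`,
`∏ i, a i = Q (∑ i, a i, ∑ i, a i ^ 2, …, ∑ i, a i ^ n)`. [folklore] -/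
theorem newton_prod_eq_aeval_psum : ∀ n : ℕ, ∃ Q : MvPolynomial (Fin n) ℚ,
    ∀ (A : Type) [CommRing A] [Algebra ℚ A] (a : Fin n → A),
    (∏ i, a i) = MvPolynomial.aeval (fun j : Fin n => ∑ i, a i ^ ((j : ℕ) + 1)) Q := by
  intro n
  obtain ⟨Q, hQ⟩ := NewtonProdPsum.exists_prod_X_eq_aeval_psum ℚ n
  refine ⟨Q, fun A _ _ a => ?_⟩
  have h := congrArg (MvPolynomial.aeval a) hQ
  rw [map_prod, comp_aeval_apply] at h
  simpa only [aeval_X, psum, map_sum, map_pow] using h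

end Summit.ValiantsHypothesis.ValiantsHypothesis.Theorems

end
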